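import Summits.Ventures.PercRepro.GZSwapC

/-!
# The K-swap of Gladkov–Zimin at the class level — part D (the rules `R***` (§8.8) and `R4` (§8.10) on `bot-2`)

Last part of the four-module split `GZSwapA` → `GZSwapB` → `GZSwapC` → `GZSwap` (the module docstring of
`GZSwapA` lists every declaration; proofs are unchanged, the preamble re-opens the section `Bot2Structure`
with the same binders). Importers keep `import Summits.Ventures.PercRepro.GZSwap`.
-/

namespace PercRepro

namespace MultiGraph

section Bot2Structure

variable {V E : Type*} (G : MultiGraph V E)

variable {G}

open Classical in
/-- **The rule `R***`** (§8.8): open every closed edge at `Q = Com_a(σ₇₂ S)` except those into `L`. -/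
noncomputable def rStar (a b c : V) (ω : Config E) : Config E :=
  fun e => ω e || decide (e ∈ G.edgesAt (G.cluster (G.kSwapSealed a c ω) a) ∧
    e ∉ G.edgesAt (G.cluster ω b))

/-- `R***` keeps every open edge open. -/
theorem rStar_eq_true_of_open {a b c : V} {ω : Config E} {e : E} (he : ω e = true) :
    G.rStar a b c ω e = true := by
  simp [rStar, he]

/-- `R***` opens the closed edges at `Q` that are not at `L`. -/
theorem rStar_eq_true_of_mem {a b c : V} {ω : Config E} {e : E}
    (hQ : e ∈ G.edgesAt (G.cluster (G.kSwapSealed a c ω) a)) (hL : e ∉ G.edgesAt (G.cluster ω b)) :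
    G.rStar a b c ω e = true := by
  simp [rStar, hQ, hL]

/-- `R***` keeps the edges at `L`. -/
theorem rStar_eq_of_mem_L {a b c : V} {ω : Config E} {e : E} (hL : e ∈ G.edgesAt (G.cluster ω b)) :
    G.rStar a b c ω e = ω e := by
  simp [rStar, hL]

/-- **Theorem 8.3 (v), the cell**: for `S ∈ bot-2`, `R***(S)` has the cell `ac|b`. -/
theorem cell_rStar_of_bot2 {a b c : V} {ω : Config E} (h : G.Bot2 ω a b c) :
    G.Conn (G.rStar a b c ω) a c ∧ ¬ G.Conn (G.rStar a b c ω) a b := by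
  have hab : ¬ G.Conn ω a b := h.2.1.1
  have hbc : ¬ G.Conn ω b c := h.2.1.2.2
  refine ⟨?_, fun hab' => ?_⟩
  · obtain ⟨e, hωe, hend⟩ := exists_edge_Q_K_M_of_bot2 h
    have key : ∀ u m : V, u ∈ G.cluster (G.kSwapSealed a c ω) a → u ∈ G.cluster ω a →
        m ∈ G.cluster ω c → ((G.fst e = u ∧ G.snd e = m) ∨ (G.fst e = m ∧ G.snd e = u)) →
        G.Conn (G.rStar a b c ω) a c := by
      intro u m huQ huK hmM hend
      -- (1) `a ~ u` in `R***`: a `σ₇₂`-open edge at `Q` is open in `R***`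
      have h1 : G.Conn (G.rStar a b c ω) a u := by
        refine conn_of_open_edges (fun e' he' he'Q => ?_) huQ
        obtain ⟨hfQ, hsQ⟩ := G.mem_cluster_both_of_open he' he'Q
        cases hω' : ω e'
        · refine G.rStar_eq_true_of_mem he'Q ?_
          rintro (hL | hL)
          · exact not_mem_cluster_b_of_bot2 h hfQ hL
          · exact not_mem_cluster_b_of_bot2 h hsQ hL
        · exact G.rStar_eq_true_of_open hω'
      -- (2) the edge `e` is opened by `R***`
      have heQ : e ∈ G.edgesAt (G.cluster (G.kSwapSealed a c ω) a) := by
        rcases hend with ⟨h1, _⟩ | ⟨_, h2⟩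
        · exact Or.inl (h1 ▸ huQ)
        · exact Or.inr (h2 ▸ huQ)
      have heL : e ∉ G.edgesAt (G.cluster ω b) := by
        have huL : u ∉ G.cluster ω b := fun hL => hab ((huK : G.Conn ω a u).trans (hL : G.Conn ω b u).symm)
        have hmL : m ∉ G.cluster ω b := fun hL => hbc ((hL : G.Conn ω b m).trans (hmM : G.Conn ω c m).symm)
        rintro (hL | hL)
        · rcases hend with ⟨h1, _⟩ | ⟨h1, _⟩
          · exact huL (h1 ▸ hL)
          · exact hmL (h1 ▸ hL)
        · rcases hend with ⟨_, h2⟩ | ⟨_, h2⟩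
          · exact hmL (h2 ▸ hL)
          · exact huL (h2 ▸ hL)
      have h2 : G.Conn (G.rStar a b c ω) u m :=
        Conn.of_openAdj ⟨e, G.rStar_eq_true_of_mem heQ heL, hend⟩
      -- (3) `c ~ m` in `R***`: open edges stay open
      have h3 : G.Conn (G.rStar a b c ω) c m :=
        conn_of_open_edges (fun _ he'' _ => G.rStar_eq_true_of_open he'') (hmM : G.Conn ω c m)
      exact (h1.trans h2).trans h3.symm
    rcases hend with ⟨hQ, hK, hM⟩ | ⟨hQ, hK, hM⟩
    · exact key _ _ hQ hK hM (Or.inl ⟨rfl, rfl⟩)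
    · exact key _ _ hQ hK hM (Or.inr ⟨rfl, rfl⟩)
  · -- `L` is untouched by `R***`
    have hL : G.cluster (G.rStar a b c ω) b = G.cluster ω b :=
      cluster_eq_of_agree fun _ he => (G.rStar_eq_of_mem_L he).symm
    have : a ∈ G.cluster (G.rStar a b c ω) b := hab'.symm
    rw [hL] at this
    exact hab (this : G.Conn ω b a).symm

/-- Every edge at `a` is open in `R***(S)` for `S ∈ bot-2` (`a ∈ Q ∩ K` has no edge into `L`). -/
theorem rStar_open_at_a_of_bot2 {a b c : V} {ω : Config E} (h : G.Bot2 ω a b c) {e : E}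
    (he : G.fst e = a ∨ G.snd e = a) : G.rStar a b c ω e = true := by
  have haQ : a ∈ G.cluster (G.kSwapSealed a c ω) a := G.self_mem_cluster _ a
  have haK : a ∈ G.cluster ω a := G.self_mem_cluster ω a
  have hab : ¬ G.Conn ω a b := h.2.1.1
  refine G.rStar_eq_true_of_mem ?_ ?_
  · rcases he with he | he
    · exact Or.inl (he ▸ haQ)
    · exact Or.inr (he ▸ haQ)
  · rintro (hL | hL)
    · rcases he with he | he
      · exact hab (he ▸ hL : G.Conn ω b a).symm
      · exact no_edge_Q_K_L_of_bot2 h e haQ haK hL (Or.inr ⟨rfl, he⟩)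
    · rcases he with he | he
      · exact no_edge_Q_K_L_of_bot2 h e haQ haK hL (Or.inl ⟨he, rfl⟩)
      · exact hab (he ▸ hL : G.Conn ω b a).symm


/-- **Theorem 8.3 (v), non-bad**: for `S ∈ bot-2`, `R***(S)` is not bad — every edge at `a` is open in
`R***(S)`, so the K-swap closes them all and isolates `a`. -/
theorem not_bad_rStar_of_bot2 {a b c : V} {ω : Config E} (h : G.Bot2 ω a b c) :
    ¬ G.Bad (G.rStar a b c ω) a b := by
  rintro ⟨_, hconn⟩
  have hne : b ≠ a := fun hba => h.2.1.1 (hba ▸ Conn.refl G ω a)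
  refine hne (eq_of_conn_of_isolated (fun e he => ?_) hconn)
  constructor
  · intro hfa
    have hmem : e ∈ G.edgesAt (G.cluster (G.rStar a b c ω) a) :=
      Or.inl (by rw [hfa]; exact G.self_mem_cluster _ a)
    rw [G.kSwap_apply_of_mem hmem, G.rStar_open_at_a_of_bot2 h (Or.inl hfa)] at he
    exact absurd he (by decide)
  · intro hsa
    have hmem : e ∈ G.edgesAt (G.cluster (G.rStar a b c ω) a) :=
      Or.inr (by rw [hsa]; exact G.self_mem_cluster _ a)
    rw [G.kSwap_apply_of_mem hmem, G.rStar_open_at_a_of_bot2 h (Or.inr hsa)] at he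
    exact absurd he (by decide)

/-- **Theorem 8.3 (v)** assembled: `R***` maps `bot-2` into the non-bad configurations of the cell `ac|b`. -/
theorem rStar_of_bot2 {a b c : V} {ω : Config E} (h : G.Bot2 ω a b c) :
    G.Conn (G.rStar a b c ω) a c ∧ ¬ G.Conn (G.rStar a b c ω) a b ∧ ¬ G.Bad (G.rStar a b c ω) a b :=
  ⟨(G.cell_rStar_of_bot2 h).1, (G.cell_rStar_of_bot2 h).2, G.not_bad_rStar_of_bot2 h⟩


/-! ### mine-3's RULE R4 (§8.10): a second valid map `bot-2 → non-bad ac|b` -/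

/-- The added edges of `R4`: from `Q ∩ K` to a vertex outside `K ∪ L`. -/
def R4Added (a b c : V) (ω : Config E) (e : E) : Prop :=
  (G.fst e ∈ G.cluster (G.kSwapSealed a c ω) a ∧ G.fst e ∈ G.cluster ω a ∧
      G.snd e ∉ G.cluster ω a ∧ G.snd e ∉ G.cluster ω b) ∨
    (G.snd e ∈ G.cluster (G.kSwapSealed a c ω) a ∧ G.snd e ∈ G.cluster ω a ∧
      G.fst e ∉ G.cluster ω a ∧ G.fst e ∉ G.cluster ω b)

open Classical in
/-- **RULE R4** (§8.10): open every edge from the `K`-part of `Q` to a vertex outside `K ∪ L`. -/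
noncomputable def rFour (a b c : V) (ω : Config E) : Config E :=
  fun e => ω e || decide (G.R4Added a b c ω e)

/-- `R4` keeps every open edge open. -/
theorem rFour_eq_true_of_open {a b c : V} {ω : Config E} {e : E} (he : ω e = true) :
    G.rFour a b c ω e = true := by
  simp [rFour, he]

/-- `R4` opens the added edges. -/
theorem rFour_eq_true_of_added {a b c : V} {ω : Config E} {e : E} (he : G.R4Added a b c ω e) :
    G.rFour a b c ω e = true := by
  simp [rFour, he]

/-- An edge closed in `R4` is closed in `ω` and not added. -/
theorem of_rFour_eq_false {a b c : V} {ω : Config E} {e : E} (he : G.rFour a b c ω e = false) :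
    ω e = false ∧ ¬ G.R4Added a b c ω e := by
  simp only [rFour, Bool.or_eq_false_iff, decide_eq_false_iff_not] at he
  exact he

/-- `R4` keeps the edges at `L` (no added edge has an endpoint in `L`). -/
theorem rFour_eq_of_mem_L {a b c : V} {ω : Config E} (hab : ¬ G.Conn ω a b) {e : E}
    (hL : e ∈ G.edgesAt (G.cluster ω b)) : G.rFour a b c ω e = ω e := by
  have hKL : ∀ v, v ∈ G.cluster ω a → v ∉ G.cluster ω b := fun v hv hv' =>
    hab ((hv : G.Conn ω a v).trans (hv' : G.Conn ω b v).symm)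
  cases hω : ω e
  · have : ¬ G.R4Added a b c ω e := by
      rintro (⟨_, hK, _, hnL⟩ | ⟨_, hK, _, hnL⟩) <;> rcases hL with hL | hL
      · exact hKL _ hK hL
      · exact hnL hL
      · exact hnL hL
      · exact hKL _ hK hL
    simp [rFour, hω, this]
  · exact G.rFour_eq_true_of_open hω

/-- **R4, the cell**: for `S ∈ bot-2`, `R4(S)` has the cell `ac|b`. -/
theorem cell_rFour_of_bot2 {a b c : V} {ω : Config E} (h : G.Bot2 ω a b c) :
    G.Conn (G.rFour a b c ω) a c ∧ ¬ G.Conn (G.rFour a b c ω) a b := by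
  have hab : ¬ G.Conn ω a b := h.2.1.1
  have hac : ¬ G.Conn ω a c := h.2.1.2.1
  have hbc : ¬ G.Conn ω b c := h.2.1.2.2
  refine ⟨?_, fun hab' => ?_⟩
  · obtain ⟨e, _, hend⟩ := exists_edge_Q_K_M_of_bot2 h
    have key : ∀ u m : V, u ∈ G.cluster (G.kSwapSealed a c ω) a → u ∈ G.cluster ω a →
        m ∈ G.cluster ω c → ((G.fst e = u ∧ G.snd e = m) ∨ (G.fst e = m ∧ G.snd e = u)) →
        G.Conn (G.rFour a b c ω) a c := by
      intro u m huQ huK hmM hend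
      have hmK : m ∉ G.cluster ω a := fun hK => hac ((hK : G.Conn ω a m).trans (hmM : G.Conn ω c m).symm)
      have hmL : m ∉ G.cluster ω b := fun hL => hbc ((hL : G.Conn ω b m).trans (hmM : G.Conn ω c m).symm)
      have hadd : G.R4Added a b c ω e := by
        rcases hend with ⟨h1, h2⟩ | ⟨h1, h2⟩
        · exact Or.inl ⟨h1 ▸ huQ, h1 ▸ huK, h2 ▸ hmK, h2 ▸ hmL⟩
        · exact Or.inr ⟨h2 ▸ huQ, h2 ▸ huK, h1 ▸ hmK, h1 ▸ hmL⟩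
      have h1 : G.Conn (G.rFour a b c ω) a u :=
        conn_of_open_edges (fun _ he' _ => G.rFour_eq_true_of_open he') (huK : G.Conn ω a u)
      have h2 : G.Conn (G.rFour a b c ω) u m :=
        Conn.of_openAdj ⟨e, G.rFour_eq_true_of_added hadd, hend⟩
      have h3 : G.Conn (G.rFour a b c ω) c m :=
        conn_of_open_edges (fun _ he'' _ => G.rFour_eq_true_of_open he'') (hmM : G.Conn ω c m)
      exact (h1.trans h2).trans h3.symm
    rcases hend with ⟨hQ, hK, hM⟩ | ⟨hQ, hK, hM⟩
    · exact key _ _ hQ hK hM (Or.inl ⟨rfl, rfl⟩)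
    · exact key _ _ hQ hK hM (Or.inr ⟨rfl, rfl⟩)
  · have hL : G.cluster (G.rFour a b c ω) b = G.cluster ω b :=
      cluster_eq_of_agree fun _ he => (G.rFour_eq_of_mem_L hab he).symm
    have : a ∈ G.cluster (G.rFour a b c ω) b := hab'.symm
    rw [hL] at this
    exact hab (this : G.Conn ω b a).symm

/-- **R4, non-bad** (§8.10): after the K-swap of `R4(S)` the cluster of `a` stays inside `Q ∩ K`, so
`a ≁ b`. -/
theorem not_bad_rFour_of_bot2 {a b c : V} {ω : Config E} (h : G.Bot2 ω a b c) :
    ¬ G.Bad (G.rFour a b c ω) a b := by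
  rintro ⟨_, hconn⟩
  have hab : ¬ G.Conn ω a b := h.2.1.1
  have hac : ¬ G.Conn ω a c := h.2.1.2.1
  set T := G.rFour a b c ω with hT
  -- `K ⊆ Com_a(T)`
  have hKT : ∀ x, x ∈ G.cluster ω a → x ∈ G.cluster T a := fun x hx =>
    conn_of_open_edges (fun _ he' _ => G.rFour_eq_true_of_open he') (hx : G.Conn ω a x)
  -- the boundary of `Q ∩ K` is closed in `σ₀(T)`: one direction, then both
  have step : ∀ e, G.kSwap a T e = true → ∀ x y : V, x ∈ G.cluster (G.kSwapSealed a c ω) a →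
      x ∈ G.cluster ω a → ((G.fst e = x ∧ G.snd e = y) ∨ (G.fst e = y ∧ G.snd e = x)) →
      y ∈ G.cluster (G.kSwapSealed a c ω) a ∧ y ∈ G.cluster ω a := by
    intro e he x y hxQ hxK hend
    -- the edge is at `Com_a(T)`, hence complemented: closed in `T`
    have heC : e ∈ G.edgesAt (G.cluster T a) := by
      rcases hend with ⟨h1, _⟩ | ⟨_, h2⟩
      · exact Or.inl (h1 ▸ hKT x hxK)
      · exact Or.inr (h2 ▸ hKT x hxK)
    rw [G.kSwap_apply_of_mem heC] at he
    have hTe : T e = false := by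
      cases hTe : T e
      · rfl
      · rw [hTe] at he; exact absurd he (by decide)
    obtain ⟨hωe, hnadd⟩ := G.of_rFour_eq_false hTe
    -- not added with `x ∈ Q ∩ K`: the other endpoint is in `K` or in `L`; `L` is excluded by (ii)
    have hyK : y ∈ G.cluster ω a := by
      by_contra hyK
      have hyL : y ∉ G.cluster ω b := fun hyL =>
        no_edge_Q_K_L_of_bot2 h e hxQ hxK hyL hend
      apply hnadd
      rcases hend with ⟨h1, h2⟩ | ⟨h1, h2⟩
      · exact Or.inl ⟨h1 ▸ hxQ, h1 ▸ hxK, h2 ▸ hyK, h2 ▸ hyL⟩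
      · exact Or.inr ⟨h2 ▸ hxQ, h2 ▸ hxK, h1 ▸ hyK, h1 ▸ hyL⟩
    -- an `ω`-closed edge inside `K` is flipped open by `σ₇₂`, so `y ∈ Q`
    have heK : e ∈ G.edgesAt (G.cluster ω a) := by
      rcases hend with ⟨h1, _⟩ | ⟨_, h2⟩
      · exact Or.inl (h1 ▸ hxK)
      · exact Or.inr (h2 ▸ hxK)
    have heM : e ∉ G.edgesAt (G.cluster ω c) := by
      have hKM : ∀ v, v ∈ G.cluster ω a → v ∉ G.cluster ω c := fun v hv hv' =>
        hac ((hv : G.Conn ω a v).trans (hv' : G.Conn ω c v).symm)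
      rintro (hM | hM) <;> rcases hend with ⟨h1, h2⟩ | ⟨h1, h2⟩
      · exact hKM _ hxK (h1 ▸ hM)
      · exact hKM _ hyK (h1 ▸ hM)
      · exact hKM _ hyK (h2 ▸ hM)
      · exact hKM _ hxK (h2 ▸ hM)
    have hτ : G.kSwapSealed a c ω e = true := by
      rw [G.kSwapSealed_apply_of_flip heK heM, hωe]
      rfl
    have heQ : e ∈ G.edgesAt (G.cluster (G.kSwapSealed a c ω) a) := by
      rcases hend with ⟨h1, _⟩ | ⟨_, h2⟩
      · exact Or.inl (h1 ▸ hxQ)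
      · exact Or.inr (h2 ▸ hxQ)
    obtain ⟨hfQ, hsQ⟩ := G.mem_cluster_both_of_open hτ heQ
    refine ⟨?_, hyK⟩
    rcases hend with ⟨_, h2⟩ | ⟨h1, _⟩
    · exact h2 ▸ hsQ
    · exact h1 ▸ hfQ
  have hbX : b ∈ {x | x ∈ G.cluster (G.kSwapSealed a c ω) a ∧ x ∈ G.cluster ω a} := by
    refine mem_of_conn_of_closed_boundary (fun e he => ?_)
      ⟨G.self_mem_cluster _ a, G.self_mem_cluster ω a⟩ hconn
    constructor
    · intro hf
      exact step e he _ _ hf.1 hf.2 (Or.inl ⟨rfl, rfl⟩)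
    · intro hs
      exact step e he _ _ hs.1 hs.2 (Or.inr ⟨rfl, rfl⟩)
  exact hab hbX.2

/-- **RULE R4 assembled** (§8.10): `R4` maps `bot-2` into the non-bad configurations of the cell `ac|b`. -/
theorem rFour_of_bot2 {a b c : V} {ω : Config E} (h : G.Bot2 ω a b c) :
    G.Conn (G.rFour a b c ω) a c ∧ ¬ G.Conn (G.rFour a b c ω) a b ∧ ¬ G.Bad (G.rFour a b c ω) a b :=
  ⟨(G.cell_rFour_of_bot2 h).1, (G.cell_rFour_of_bot2 h).2, G.not_bad_rFour_of_bot2 h⟩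

end Bot2Structure

end MultiGraph

end PercRepro
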